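import Literature.AnabelianGeometry.EtaleTheta.SettingModelTateProp15iii
import Literature.AnabelianGeometry.EtaleTheta.Discharge.Sec1Prop15iiiForcesShear
import HarnessLib

/-!
# The STAGE-2 (Tate-sheared) χ-model of [EtTh] §1 (row R270′, generic `(i, j)`): the typed Prop. 1.5 (iii) PINS THE
# SHEAR EXPONENT — at `modelχq p i j` (`actχq σ = Inn(b^{κ_p^i}) ∘ shear_{κ_p^j} ∘ θ_χ`) it FAILS for EVERY `j ≠ 2`

S. Mochizuki, *The étale theta function and its Frobenioid-theoretic manifestations*, Publ. RIMS **45** (2009)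
[EtTh], §1, Prop. 1.5 (iii), PRIMS PDF p. 23 (printed 249): "… on which `a ∈ Z` acts as follows:
`η̈^Θ ↦ η̈^Θ − 2a·log(Ü) − (a²/2)·log(q_X) + log(O^×_K̈)`" [cite: MochizukiEtTh2009, Prop 1.5 (iii) p.23]. Layer L2 of
the abc-iut cell, R78 cluster STAGE 2, row R270′ «Prop 1.5 (iii) at generic (i, j)» (abc-iut-L2-lead R362), seat
abc-iut-L2-t12 (gen 6). PROOF-ONLY (0 definitions) over this seat's gen-5 no-go engine
`EtaleThetaData.sq_conj_logUdd_of_prop15iii` (`Discharge/Sec1Prop15iiiForcesShear`: the typed `Z`-display at `σ₀`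
and `σ₀²` forces `(σ₀·log Ü)² = (log Ü)²·κ(q̈)²·κ(w)`, `w ∈ O^×_K̈`), abc-iut-L2-t6's generic-`(i,j)` deck levels
(`yCoordχq_deckConj`: `ŷ(σ₀⁻¹gσ₀) = ŷ(g)·κ_p(τ)^j`, `kumYdd_toKddHat_qddUnit_eq_mk`: `κ̈(q̈)` is the class of
`h ↦ c^{κ_p(aug^Θ h)}`, `SettingModelTateDeckLevels`), abc-iut-w5-d171's F6q `kummerCoreχq`/`yCoordKitχq`,
abc-iut-L2-t6's retraction `kumYdd_toKddHat_ofSection_modelχq`, and this seat's D2 `conj_kumYdd_units_ofSection` /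
`conj_kumYdd_qddUnit_ofSection` — all BY NAME.

RESULTS (every `i`, every even `j`, every Galois section `s`, every class `η̈`, every `hC`):
* `qddUnit_zpow_mem_unitsOKdd_iff` — `q̈^n ∈ O^×_K̈ ↔ n = 0` (`‖q̈‖ < 1`; generic theta setting);
* **`sq_conj_deckGen_logUdd_modelχq`** — `(σ₀·log Ü)² = (log Ü)² · κ̈(q̈)^j` at the deck generator `σ₀ = (a, 1)` of
  `modelχq p i j` (the generic-`j` SQUARED form of abc-iut-L2-t6's `j = 2` display `conj_deckGen_logUdd`);
* **`not_prop15iii_modelχq_of_ne_two`** — for `j ≠ 2` the typed `Prop15iii` FAILS for the étale-theta datum of EVERY class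
  `η̈` over the section Kummer datum of `kummerCoreχq p i j` along ANY `s`: comparing the two squares gives
  `κ̈(q̈)^{j−2} = κ̈(w)` with `w` a unit, i.e. (Kummer maps injective) `q̈^{j−2} ∈ O^×_K̈`, i.e. `j = 2`;
* `prop15iii_etaDdχq_only_if_two` / **`prop15iii_etaDdχq_one_iff`** — with abc-iut-L2-t6's positive instance at
  `(1, 2)`: for `i = 1`, `Prop15iii(E_{1,j}) ↔ j = 2`; census `forall_not_prop15iii_modelχq_zero` (the `j = 0` member
  of the stage-2 family behaves like the split stage-1 model: deck-invariant `log(Ü)`).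
READING: the `−(a²/2)·log(q_X)` / `−2a·log(Ü)` terms of print's display are what force the Tate shear
`Ü ↦ q̈^a·Ü` (`j = 2 = κ(q_X)/κ(q̈)`); the inner exponent `i` is not constrained by the `log(Ü)`-part (it enters only
the `x′`-display — not treated here). HONEST FRAMING: SEMI-SYNTHETIC model — consistency/sharpness evidence for the
typed interface ONLY; nothing of [EtTh] is asserted or denied; typed ≠ proved; no side is taken on [IUTchIII] Cor. 3.12.
-/

noncomputable section

namespace Literature.AnabelianGeometry.EtaleTheta

open Literature.AnabelianGeometry.SemiGraphs

/-! ### Generic: powers of `q̈` are units only trivially -/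

namespace ThetaSetting

variable {p : ℕ} [Fact p.Prime] (D : ThetaSetting p)

/-- **`q̈^n ∈ O^×_K̈ ↔ n = 0`** (`0 < ‖q̈‖ < 1`). [cite: MochizukiEtTh2009, §1 p.17] -/
theorem qddUnit_zpow_mem_unitsOKdd_iff (n : ℤ) : D.qddUnit ^ n ∈ D.unitsOKdd ↔ n = 0 := by
  have hq : ((D.qddUnit : D.Kdd) : PadicAlgCl p) = D.qdd := rfl
  have key : ∀ m : ℕ, D.qddUnit ^ m ∈ D.unitsOKdd → m = 0 := by
    intro m hm
    by_contra hm0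
    have h1 : ‖(((D.qddUnit ^ m : (↥D.Kdd)ˣ) : D.Kdd) : PadicAlgCl p)‖ = 1 := hm
    rw [Units.val_pow_eq_pow_val] at h1
    push_cast at h1
    rw [hq, norm_pow] at h1
    exact absurd h1 (ne_of_lt (pow_lt_one₀ (norm_nonneg _) D.norm_qdd_lt_one hm0))
  constructor
  · intro h
    obtain ⟨m, rfl | rfl⟩ := Int.eq_nat_or_neg n
    · exact_mod_cast key m (by rwa [zpow_natCast] at h)
    · have h' : D.qddUnit ^ (m : ℤ) ∈ D.unitsOKdd := by
        rw [zpow_neg] at h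
        exact (Subgroup.inv_mem_iff _).mp h
      rw [zpow_natCast] at h'
      rw [key m h', Int.ofNat_zero, neg_zero]
  · rintro rfl
    rw [zpow_zero]
    exact one_mem _

end ThetaSetting

namespace SettingModel

variable (p : ℕ) [Fact p.Prime] (i j : ℤ) (hj : Even j)

/-! ### The squared deck display of `log(Ü)` at generic `(i, j)` -/

/-- **`(σ₀·log Ü)² = (log Ü)² · κ̈(q̈)^j`** at the deck generator `σ₀ = (a, 1)` of `modelχq p i j` (every `i`, even `j`):
on cocycles `(c^{ŷ(σ₀⁻¹hσ₀)/2})² = c^{ŷ(h)} · (c^{κ_p(aug^Θ h)})^j` by abc-iut-L2-t6's `yCoordχq_deckConj`; `σ₀` centralises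
`Δ_Θ`. [cite: MochizukiEtTh2009, Prop 1.5 (iii) p.23] -/
theorem sq_conj_deckGen_logUdd_modelχq (hC : (ThetaSetting.modelχq p i j hj).Compat) :
    haveI := hC.GtpYddTheta_normal
    (ContH1.conj (MonoidHom.id (ThetaSetting.modelχq p i j hj).GtpTheta) (ThetaSetting.modelχq p i j hj).DeltaTheta
        ((ThetaSetting.modelχq p i j hj).toTheta (SemidirectProduct.inl (gfpOf (FreeGroup.of 0))))
        (kummerCoreχq p i j hj).logUdd) ^ 2 =
      (kummerCoreχq p i j hj).logUdd ^ 2 *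
        (kummerCoreχq p i j hj).toKummerData.kumYdd
          ((kummerCoreχq p i j hj).toKummerData.toKddHat (ThetaSetting.modelχq p i j hj).qddUnit) ^ j := by
  haveI := hC.GtpYddTheta_normal
  letI := (ThetaSetting.modelχq p i j hj).unitsAction (kummerCoreχq p i j hj).augTheta
  rw [kumYdd_toKddHat_qddUnit_eq_mk]
  set K := (kummerCoreχq p i j hj).coeff.kummerContCocycle
    ((ThetaSetting.modelχq p i j hj).GtpYdd.map (ThetaSetting.modelχq p i j hj).toTheta)
    ((pRoots p).cast (pUnit_eq_toInvYdd_qddUnit p i j hj))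
    ((kummerCoreχq p i j hj).toInvYdd (ThetaSetting.modelχq p i j hj).qddUnit).2
    (fun _ => (kummerCoreχq p i j hj).isOpen_stabilizer' _) with hK
  set F : contCocycles (MonoidHom.id (ThetaSetting.modelχq p i j hj).GtpTheta) (ThetaSetting.modelχq p i j hj).DeltaTheta
      ((ThetaSetting.modelχq p i j hj).GtpYdd.map (ThetaSetting.modelχq p i j hj).toTheta) :=
    ⟨(yCoordKitχq p i j hj).logUddFun, (yCoordKitχq p i j hj).logUddFun_mem⟩ with hF
  let π : ↥(contCocycles (MonoidHom.id (ThetaSetting.modelχq p i j hj).GtpTheta) (ThetaSetting.modelχq p i j hj).DeltaTheta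
      ((ThetaSetting.modelχq p i j hj).GtpYdd.map (ThetaSetting.modelχq p i j hj).toTheta)) →*
      (ThetaSetting.modelχq p i j hj).H1Theta
        ((ThetaSetting.modelχq p i j hj).GtpYdd.map (ThetaSetting.modelχq p i j hj).toTheta) :=
    QuotientGroup.mk' _
  show (ContH1.conj (MonoidHom.id (ThetaSetting.modelχq p i j hj).GtpTheta) (ThetaSetting.modelχq p i j hj).DeltaTheta
      ((ThetaSetting.modelχq p i j hj).toTheta (SemidirectProduct.inl (gfpOf (FreeGroup.of 0)))) (π F)) ^ 2 =
    (π F) ^ 2 * (π K) ^ j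
  have e1 : (ContH1.conj (MonoidHom.id (ThetaSetting.modelχq p i j hj).GtpTheta) (ThetaSetting.modelχq p i j hj).DeltaTheta
      ((ThetaSetting.modelχq p i j hj).toTheta (SemidirectProduct.inl (gfpOf (FreeGroup.of 0)))) (π F)) ^ 2 =
      π (ContH1.conjCocycle (MonoidHom.id (ThetaSetting.modelχq p i j hj).GtpTheta) (ThetaSetting.modelχq p i j hj).DeltaTheta
        ((ThetaSetting.modelχq p i j hj).toTheta (SemidirectProduct.inl (gfpOf (FreeGroup.of 0)))) (F ^ 2)) := by
    rw [← map_pow, ← map_pow]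
    rfl
  rw [e1, ← map_pow π, ← map_zpow π, ← map_mul π]
  congr 1
  refine Subtype.ext (funext fun h => ?_)
  obtain ⟨g, hg, hgh⟩ := h.2
  have hg0 : gfpSnd g.left = 1 :=
    gfpSnd_left_eq_one_of_mem_gtpY_modelχq p i j hj ((ThetaSetting.modelχq p i j hj).GtpYdd_le_GtpY hg)
  rw [ContH1.conjCocycle_apply, MonoidHom.id_apply]
  refine (conjNormal_toThetaq_eq_self p i j hj (SemidirectProduct.right_inl _) _).trans ?_
  apply Subtype.ext
  simp only [Subgroup.coe_mul, Subgroup.coe_pow, Subgroup.coe_zpow, Pi.mul_apply, Pi.pow_apply]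
  rw [coe_kummerContCocycle_qdd_apply]
  change (cThetaχq p i j (half ⟨yThetaχq p i j _, _⟩)) ^ 2 =
    (cThetaχq p i j (half ⟨yThetaχq p i j _, _⟩)) ^ 2 * (cThetaχq p i j (kappaP p (CurveTheta.augTheta (curveχq p i j) h.1))) ^ j
  rw [← map_pow (cThetaχq p i j), ← map_pow (cThetaχq p i j), ← map_zpow (cThetaχq p i j),
    ← map_mul (cThetaχq p i j), half_sq, half_sq]
  congr 1
  change yThetaχq p i j ((MulAut.conjNormal ((ThetaSetting.modelχq p i j hj).toTheta
      (SemidirectProduct.inl (gfpOf (FreeGroup.of 0))))⁻¹ h : _) : _) =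
    yThetaχq p i j h.1 * kappaP p (CurveTheta.augTheta (curveχq p i j) h.1) ^ j
  rw [MulAut.conjNormal_apply, inv_inv, ← hgh]
  change yThetaχq p i j ((CurveTheta.toTheta (curveχq p i j) (SemidirectProduct.inl (gfpOf (FreeGroup.of 0))))⁻¹ *
      CurveTheta.toTheta (curveχq p i j) g * CurveTheta.toTheta (curveχq p i j)
        (SemidirectProduct.inl (gfpOf (FreeGroup.of 0)))) =
    yThetaχq p i j (CurveTheta.toTheta (curveχq p i j) g) *
      kappaP p (CurveTheta.augTheta (curveχq p i j) (CurveTheta.toTheta (curveχq p i j) g)) ^ j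
  rw [← map_inv, ← map_mul, ← map_mul, yThetaχq_toTheta, yThetaχq_toTheta, CurveTheta.augTheta_toTheta,
    yCoordχq_deckConj p i j hg0]
  rfl

/-! ### The no-go for `j ≠ 2` -/

section OfSection

variable (s : GQp p →* (ThetaSetting.modelχq p i j hj).PiTemp) (hs : Continuous s)
  (hsec : ∀ σ : GQp p, (ThetaSetting.modelχq p i j hj).aug (s σ) = σ)
  (hsY : (ThetaSetting.modelχq p i j hj).GK.map s ≤ (ThetaSetting.modelχq p i j hj).GtpY)
  (hsYdd : (ThetaSetting.modelχq p i j hj).GKdd.map s ≤ (ThetaSetting.modelχq p i j hj).GtpYdd)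

/-- **The typed Prop. 1.5 (iii) FAILS at `modelχq p i j` for every `j ≠ 2`** (every `i`, every section `s`, every class
`η̈` over the section Kummer datum of `kummerCoreχq`): the `Z`-display (this seat's engine
`sq_conj_logUdd_of_prop15iii`) gives `(σ₀·log Ü)² = (log Ü)²·κ̈(q̈)²·κ̈(w)` with `w ∈ O^×_K̈`, the model gives
`(σ₀·log Ü)² = (log Ü)²·κ̈(q̈)^j`; hence `κ̈(q̈^{j−2}) = κ̈(w)`, so `q̈^{j−2}` is a unit — `j = 2`.
[cite: MochizukiEtTh2009, Prop 1.5 (iii) p.23] -/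
theorem not_prop15iii_modelχq_of_ne_two (hj2 : j ≠ 2) (hC : (ThetaSetting.modelχq p i j hj).Compat)
    (η : (ThetaSetting.modelχq p i j hj).H1 (ThetaSetting.modelχq p i j hj).GtpYdd) :
    ¬ ThetaSetting.Prop15iii
      (((kummerCoreχq p i j hj).toKummerDataOfSection s hs hsec hsY hsYdd).etaleThetaDataOfClass η) hC := by
  haveI := hC.GtpYddTheta_normal
  intro h15
  obtain ⟨w, hw, hsq⟩ :=
    (((kummerCoreχq p i j hj).toKummerDataOfSection s hs hsec hsY hsYdd).etaleThetaDataOfClass η).sq_conj_logUdd_of_prop15iii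
      hC ((kummerCoreχq p i j hj).conj_kumYdd_units_ofSection s hs hsec hsY hsYdd hC)
      ((kummerCoreχq p i j hj).conj_kumYdd_qddUnit_ofSection s hs hsec hsY hsYdd hC) (toZ_inl_gfpOf_a p i j hj) h15
  -- both sides live on the section datum; move the unit classes to the core and compare with the model's square
  have hsq2 : (ContH1.conj (MonoidHom.id (ThetaSetting.modelχq p i j hj).GtpTheta) (ThetaSetting.modelχq p i j hj).DeltaTheta
        ((ThetaSetting.modelχq p i j hj).toTheta (SemidirectProduct.inl (gfpOf (FreeGroup.of 0))))
        (kummerCoreχq p i j hj).logUdd) ^ 2 =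
      (kummerCoreχq p i j hj).logUdd ^ 2 *
        (kummerCoreχq p i j hj).toKummerData.kumYdd
          ((kummerCoreχq p i j hj).toKummerData.toKddHat (ThetaSetting.modelχq p i j hj).qddUnit) ^ 2 *
        (kummerCoreχq p i j hj).toKummerData.kumYdd ((kummerCoreχq p i j hj).toKummerData.toKddHat w) := by
    rw [← kumYdd_toKddHat_ofSection_modelχq p i j hj s hs hsec hsY hsYdd,
      ← kumYdd_toKddHat_ofSection_modelχq p i j hj s hs hsec hsY hsYdd]
    exact hsq
  rw [sq_conj_deckGen_logUdd_modelχq p i j hj hC, mul_assoc] at hsq2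
  have hsq' := mul_left_cancel hsq2
  rw [← map_zpow, ← map_zpow, ← map_pow, ← map_pow, ← map_mul, ← map_mul] at hsq'
  have heq : (ThetaSetting.modelχq p i j hj).qddUnit ^ j = (ThetaSetting.modelχq p i j hj).qddUnit ^ 2 * w :=
    (kummerCoreχq p i j hj).toKummerData.toKddHat_injective ((kummerCoreχq p i j hj).toKummerData.kumYdd_injective hsq')
  have hmem : (ThetaSetting.modelχq p i j hj).qddUnit ^ (j - 2) ∈ (ThetaSetting.modelχq p i j hj).unitsOKdd := by
    have e : (ThetaSetting.modelχq p i j hj).qddUnit ^ (j - 2) = w := by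
      rw [show j - 2 = -((2 : ℕ) : ℤ) + j by omega, zpow_add, zpow_neg, zpow_natCast, heq, ← mul_assoc,
        inv_mul_cancel, one_mul]
    rw [e]
    exact hw
  exact hj2 (sub_eq_zero.mp (((ThetaSetting.modelχq p i j hj).qddUnit_zpow_mem_unitsOKdd_iff _).mp hmem))

end OfSection

/-- **For the `z`-class datum of record: `Prop15iii ⇒ j = 2`** (any `i`, any section). [cite: MochizukiEtTh2009, Prop 1.5 (iii) p.23] -/
theorem prop15iii_etaDdχq_only_if_two (hC : (ThetaSetting.modelχq p i j hj).Compat)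
    (s : GQp p →* (ThetaSetting.modelχq p i j hj).PiTemp) (hs : Continuous s)
    (hsec : ∀ σ : GQp p, (ThetaSetting.modelχq p i j hj).aug (s σ) = σ)
    (hsY : (ThetaSetting.modelχq p i j hj).GK.map s ≤ (ThetaSetting.modelχq p i j hj).GtpY)
    (hsYdd : (ThetaSetting.modelχq p i j hj).GKdd.map s ≤ (ThetaSetting.modelχq p i j hj).GtpYdd)
    (h15 : ThetaSetting.Prop15iii
      (((kummerCoreχq p i j hj).toKummerDataOfSection s hs hsec hsY hsYdd).etaleThetaDataOfClass (etaDdχq p i j hj)) hC) :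
    j = 2 := by
  by_contra hj2
  exact not_prop15iii_modelχq_of_ne_two p i j hj s hs hsec hsY hsYdd hj2 hC _ h15

/-- **At `i = 1`: the typed Prop. 1.5 (iii) for `η̈♯ = etaDdχq` (any section `s`) holds IFF `j = 2`** — abc-iut-L2-t6's
positive instance `prop15iii_etaleThetaDataOfClass_etaDdχq` at `(1, 2)` + the no-go above: the SHEAR EXPONENT of the
stage-2 model is PINNED by Prop. 1.5 (iii) to `j = 2 = κ(q_X)/κ(q̈)`. [cite: MochizukiEtTh2009, Prop 1.5 (iii) p.23] -/
theorem prop15iii_etaDdχq_one_iff (hj : Even j) (hC : (ThetaSetting.modelχq p 1 j hj).Compat)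
    (s : GQp p →* (ThetaSetting.modelχq p 1 j hj).PiTemp) (hs : Continuous s)
    (hsec : ∀ σ : GQp p, (ThetaSetting.modelχq p 1 j hj).aug (s σ) = σ)
    (hsY : (ThetaSetting.modelχq p 1 j hj).GK.map s ≤ (ThetaSetting.modelχq p 1 j hj).GtpY)
    (hsYdd : (ThetaSetting.modelχq p 1 j hj).GKdd.map s ≤ (ThetaSetting.modelχq p 1 j hj).GtpYdd) :
    ThetaSetting.Prop15iii
        (((kummerCoreχq p 1 j hj).toKummerDataOfSection s hs hsec hsY hsYdd).etaleThetaDataOfClass (etaDdχq p 1 j hj))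
        hC ↔ j = 2 := by
  refine ⟨prop15iii_etaDdχq_only_if_two p 1 j hj hC s hs hsec hsY hsYdd, ?_⟩
  rintro rfl
  exact prop15iii_etaleThetaDataOfClass_etaDdχq p hC s hs hsec hsY hsYdd

/-- **Census (the `j = 0` member of the stage-2 family = the deck-unsheared twist `(κ_p^i, 1, χ)`)**: the typed
Prop. 1.5 (iii) FAILS there for every `i`, every section, every `η̈` — as at the split stage-1 model `modelχ`
(this seat's `not_prop15iii_etaleThetaDataχSec`). [cite: MochizukiEtTh2009, Prop 1.5 (iii) p.23] -/
theorem forall_not_prop15iii_modelχq_zero (hC : (ThetaSetting.modelχq p i 0 Even.zero).Compat)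
    (s : GQp p →* (ThetaSetting.modelχq p i 0 Even.zero).PiTemp) (hs : Continuous s)
    (hsec : ∀ σ : GQp p, (ThetaSetting.modelχq p i 0 Even.zero).aug (s σ) = σ)
    (hsY : (ThetaSetting.modelχq p i 0 Even.zero).GK.map s ≤ (ThetaSetting.modelχq p i 0 Even.zero).GtpY)
    (hsYdd : (ThetaSetting.modelχq p i 0 Even.zero).GKdd.map s ≤ (ThetaSetting.modelχq p i 0 Even.zero).GtpYdd) :
    ∀ η : (ThetaSetting.modelχq p i 0 Even.zero).H1 (ThetaSetting.modelχq p i 0 Even.zero).GtpYdd,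
      ¬ ThetaSetting.Prop15iii
        (((kummerCoreχq p i 0 Even.zero).toKummerDataOfSection s hs hsec hsY hsYdd).etaleThetaDataOfClass η) hC :=
  fun η => not_prop15iii_modelχq_of_ne_two p i 0 Even.zero s hs hsec hsY hsYdd (by decide) hC η

end SettingModel

end Literature.AnabelianGeometry.EtaleTheta

end
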